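import Summits.QuantumFields.YangMills.Theorems.BalabanUVNodesN16Eq42PermutationDefect
import Summits.QuantumFields.BalabanUV.T4Continuum.Support.AbelianBlockAverage
import HarnessLib

/-!
# YM-DAG node N16 (NE3), the located averaging pin (42) ↔ (0.4) — THE PERMUTATION DEFECT OF (42), part 2 of 2: THE ABELIAN AVERAGE
# ITSELF — (42) IS relabelling-equivariant at every constant-flux abelian field; relative Lipschitz-flux defect bound; non-flat witnesses

Cell `pub-ymgap`, width seat `pub-ymgap-dag-n16-w3` (director-ym №197 ∕ HUMAN RULING D-0149), generation 2; part 2 of the W1b sequel over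
part 1 `BalabanUVNodesN16Eq42PermutationDefect` (the LINEARISED level: exact defect identity, constant flux ⇒ no defect, Lipschitz flux ⇒
defect `≤ d(d+2)L³δ`, loop sums from a flux bound, constant-flux fields exist).  `--kind proof --supports stmt-QuantumFields-20544 --as helper`
(K3⁷; count-neutral).  `bears_on: R4∕N16`.

THE POINT.  In a COMMUTATIVE complete normed `ℂ`-algebra the tree's (42) is EXACTLY `exp` of the linear contour average,
`bavg L (exp ∘ A) c = exp (T_c[A])` inside the ball of the logarithm (`AbelianBlockAverage.bavg_expUnit`), and relabelling the axes commutes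
with `exp ∘ ·` bondwise; so part 1's statements about `T_c` exponentiate:
 * §1 ★★ **(42) IS RELABELLING-EQUIVARIANT AT EVERY CONSTANT-FLUX ABELIAN FIELD** `W = exp ∘ A` (all plaquette circulations independent
   of the base point, `d·L²·‖f m k‖ < log 2`): `bavg L (permCfg σ W) = permCfg σ (bavg L W)` (`bavg_permCfg_expUnit_of_const_flux`,
   `permEquivariant_pointwise_of_const_flux`) — the instance of (α)'s refuted Prop `PermEquivariantAt (bavg L) σ`
   (`B7Eq42NotEuclideanSymmetric.not_permEquivariant_bavg`: a single-defect field, flux = a lattice delta) is TRUE at such fields;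
 * §1 ★★ **THE RELATIVE LIPSCHITZ-FLUX DEFECT BOUND**: with a flux bound `φ` (`d L² φ < log 2`) and circulations `δ`-Lipschitz in the
   base point near `r_σ q`, `‖V̄[r_σW](q,κ) − (r_σV̄[W])(q,κ)‖ ≤ ‖(r_σV̄[W])(q,κ)‖·(e^{d(d+2)L³δ} − 1)`
   (`norm_bavg_permCfg_expUnit_sub_le`; `‖e^x − e^y‖ ≤ ‖e^y‖(e^{‖x−y‖} − 1)` for commuting `x, y`, `norm_exp_sub_exp_le`);
 * §2 **NON-VACUITY**: for every small antisymmetric constant curvature `f` there is a NON-FLAT field with that curvature at which (42)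
   is equivariant (`exists_nonflat_equivariant`, from part 1's linear potential).

READING FOR N16 (honest; no theorem about minimisers here).  On a level-`j` configuration of [B11]-Thm-1 TYPE regularity (flux `≤ bη²`,
flux Lipschitz constant `δ = cη³`, `η = L^{−j}`) the relative relabelling defect of (42) per coarse bond is `e^{d(d+2)L³cη³} − 1 =
O(d²L³·c·η³)`, against (42)'s own first-order deviation `X̂ = O(dL²·b·η²)` from the straight transporter: relative size `O(Lcη∕b) → 0`
— the Euclidean asymmetry recorded by the located pin (p584628 `Transfer42to04 ∕ Transfer04to42`, displayed hypotheses) is a LATTICE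
ARTEFACT invisible at the continuum scale on regular abelian fields ([Balaban1987RG1] p. 254 «both definitions are equally good for our
purposes»).  It does NOT prove the transfer (different constraint manifolds) and says nothing non-abelian ([B7] Prop. 1's `O(a²)` terms).

HONEST FRAMING.  [folklore] bookkeeping over part 1 and `AbelianBlockAverage` BY NAME; 0 `def`, 0 `sorry`; no printed sentence is a
hypothesis; nothing of [Balaban1985Averaging] ∕ [Balaban1987RG1] asserted beyond what the tree proves; no minimiser, no variational
problem; `stub_h7` NOT closed; N16 ∕ NE3 NOT discharged; count-neutral (typed 28∕28 · discharged 5∕27 unmoved).  One finite four-torus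
programme at fixed `ε` — the Yang–Mills mass gap (Clay) is NOT proved by any of this; R4 closes the conditional finite-𝕋⁴ rung
`BalabanLadder.UV` only; nothing continuum ∕ ℝ⁴ ∕ OS.
-/

set_option autoImplicit false

open scoped BigOperators
open NormedSpace Finset

namespace Summit.QuantumFields.YangMills.BalabanUVNodes.N16Eq42PermutationDefectAbelian

open Literature.MathematicalPhysics.QuantumFieldTheory.Balaban1983to89
open B7Prop1Explicit
open B12Average012Permutation (permSite permCfg permCfg_apply)
open Summit.QuantumFields.BalabanUV.T4Continuum.AbelianBlockAverage (bavg_expUnit)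
open Summit.QuantumFields.YangMills.BalabanUVNodes.N16Eq42PermutationDefect

noncomputable section

variable {d : ℕ}

/-! ## §1 The abelian average: (42) IS relabelling-equivariant at constant-flux fields; the relative Lipschitz-flux defect bound -/

section Comm

variable {𝔸 : Type*} [NormedCommRing 𝔸] [NormedAlgebra ℂ 𝔸] [CompleteSpace 𝔸]

/-- Relabelling commutes with exponentiating a bond field bondwise. [folklore] -/
theorem permCfg_expUnit (σ : Equiv.Perm (Fin d)) (A : Site d → Fin d → 𝔸) :
    permCfg σ (fun y μ => expUnit (A y μ)) = fun y μ => expUnit (permCfg σ A y μ) := rfl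

/-- **★★ (42) IS RELABELLING-EQUIVARIANT AT EVERY CONSTANT-FLUX ABELIAN FIELD.**  In a commutative complete normed
`ℂ`-algebra let `W = exp ∘ A` bondwise, and suppose ALL plaquette circulations of `A` are independent of the base point,
`A(∂p)_p(plaqWord m k) = f m k`, with `d·L²·‖f m k‖ < log 2` (the loop variables of (42) then lie in the ball of the logarithm,
`loop_small_of_flux`; the bond field itself may grow linearly — constant curvature).  Then averaging the relabelled field IS
relabelling the averaged field: `bavg L (permCfg σ W) = permCfg σ (bavg L W)` — in contrast with (α)
`B7Eq42NotEuclideanSymmetric.not_permEquivariant_bavg` (a single-defect field, whose flux is a lattice delta).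
[`AbelianBlockAverage.bavg_expUnit` on both sides + `Tside_permCfg_of_const_flux`.] [folklore] -/
theorem bavg_permCfg_expUnit_of_const_flux (L : ℕ) (hL : 1 ≤ L) (σ : Equiv.Perm (Fin d)) (A : Site d → Fin d → 𝔸)
    (f : Fin d → Fin d → 𝔸) (hf : ∀ (p : Site d) (m k : Fin d), asum A p (plaqWord m k) = f m k) {φ : ℝ} (hφ0 : 0 ≤ φ)
    (hφ : ∀ m k : Fin d, ‖f m k‖ ≤ φ) (hφL : d * (L : ℝ) ^ 2 * φ < Real.log 2) :
    bavg L (permCfg σ fun y μ => expUnit (A y μ)) = permCfg σ (bavg L fun y μ => expUnit (A y μ)) := by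
  funext q κ
  have hA : ∀ (k : Fin d) (p : Site d) (m : Fin d), ‖asum A p (plaqWord m k)‖ ≤ φ := fun k p m => by
    rw [hf]; exact hφ _ _
  rw [permCfg_expUnit, permCfg_apply,
    bavg_expUnit L hL (permCfg σ A) q κ
      (loop_small_of_flux L (permCfg σ A) q κ hφ0 (flux_bound_permCfg σ A κ (hA (σ κ))) hφL),
    bavg_expUnit L hL A (permSite σ q) (σ κ) (loop_small_of_flux L A _ _ hφ0 (hA (σ κ)) hφL),
    Tside_permCfg_of_const_flux L hL σ A q κ (fun m => f m (σ κ)) (fun p m => hf p m (σ κ))]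

/-- So at such a field the equivariance SHAPE of (α) holds pointwise (the Prop `PermEquivariantAt (bavg L) σ` quantifies over ALL
fields and is refuted in (α)∕(α′); its instance at a constant-flux abelian field is true). [folklore] -/
theorem permEquivariant_pointwise_of_const_flux (L : ℕ) (hL : 1 ≤ L) (σ : Equiv.Perm (Fin d))
    (A : Site d → Fin d → 𝔸) (f : Fin d → Fin d → 𝔸) (hf : ∀ (p : Site d) (m k : Fin d), asum A p (plaqWord m k) = f m k)
    {φ : ℝ} (hφ0 : 0 ≤ φ) (hφ : ∀ m k : Fin d, ‖f m k‖ ≤ φ) (hφL : d * (L : ℝ) ^ 2 * φ < Real.log 2)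
    (q : Site d) (κ : Fin d) :
    bavg L (permCfg σ fun y μ => expUnit (A y μ)) q κ = permCfg σ (bavg L fun y μ => expUnit (A y μ)) q κ := by
  rw [bavg_permCfg_expUnit_of_const_flux L hL σ A f hf hφ0 hφ hφL]

/-- `‖e^x − e^y‖ ≤ ‖e^y‖·(e^{‖x − y‖} − 1)` for commuting `x, y` (here: a commutative algebra; tree bound `‖e^B − 1‖ ≤ e^{‖B‖} − 1`).
[folklore] -/
theorem norm_exp_sub_exp_le (x y : 𝔸) : ‖exp x - exp y‖ ≤ ‖exp y‖ * (Real.exp ‖x - y‖ - 1) := by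
  letI : NormedAlgebra ℚ 𝔸 := NormedAlgebra.restrictScalars ℚ ℂ 𝔸
  have h : exp x = exp y * exp (x - y) := by
    rw [← exp_add_of_commute (Commute.all _ _), add_sub_cancel]
  rw [h, ← mul_sub_one]
  exact (norm_mul_le _ _).trans
    (mul_le_mul_of_nonneg_left (norm_exp_sub_one_le_of_norm_le le_rfl).1 (norm_nonneg _))

/-- **★★ THE LIPSCHITZ-FLUX DEFECT BOUND FOR THE ABELIAN AVERAGE (42) (relative form).**  With `W = exp ∘ A`, a flux bound
`‖A(∂p)_p(plaqWord m (σκ))‖ ≤ φ`, `d·L²·φ < log 2` (ball of the logarithm for both averaged bonds), and circulations in the planes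
`(m, σκ)` that are `δ`-Lipschitz in the base point near `q′ = r_σ q`:
`‖(bavg L (permCfg σ W))(q,κ) − (permCfg σ (bavg L W))(q,κ)‖ ≤ ‖(permCfg σ (bavg L W))(q,κ)‖ · (e^{d(d+2)L³δ} − 1)`.
For a level-`j` field of [B11]-Thm-1 TYPE regularity (flux `≤ b η²`, flux Lipschitz constant `δ = c η³`, `η = L^{−j}`) the
relative defect is `O(d²L³·c·η³)`, against the first-order term `X̂ = O(dL²·b·η²)` by which (42) itself deviates from the straight
transporter: the Euclidean asymmetry of (42) is a LATTICE ARTEFACT of relative size `O(L c η ∕ b)` on regular fields (cf.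
[Balaban1987RG1] p. 254 «both definitions are equally good for our purposes»). [folklore] -/
theorem norm_bavg_permCfg_expUnit_sub_le (L : ℕ) (hL : 1 ≤ L) (σ : Equiv.Perm (Fin d)) (A : Site d → Fin d → 𝔸)
    (q : Site d) (κ : Fin d) {φ : ℝ} (hφ0 : 0 ≤ φ)
    (hφ : ∀ (p : Site d) (m : Fin d), ‖asum A p (plaqWord m (σ κ))‖ ≤ φ) (hφL : d * (L : ℝ) ^ 2 * φ < Real.log 2)
    {δ : ℝ} (hδ0 : 0 ≤ δ)
    (hδ : ∀ (p : Site d) (m : Fin d), l1 (p - permSite σ q) ≤ (d + 2) * L →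
      ‖asum A p (plaqWord m (σ κ)) - asum A (permSite σ q) (plaqWord m (σ κ))‖ ≤ δ * l1 (p - permSite σ q)) :
    ‖((bavg L (permCfg σ fun y μ => expUnit (A y μ)) q κ : 𝔸ˣ) : 𝔸)
        - ((permCfg σ (bavg L fun y μ => expUnit (A y μ)) q κ : 𝔸ˣ) : 𝔸)‖
      ≤ ‖((permCfg σ (bavg L fun y μ => expUnit (A y μ)) q κ : 𝔸ˣ) : 𝔸)‖
          * (Real.exp (d * (d + 2) * (L : ℝ) ^ 3 * δ) - 1) := by
  rw [permCfg_expUnit, permCfg_apply,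
    bavg_expUnit L hL (permCfg σ A) q κ (loop_small_of_flux L (permCfg σ A) q κ hφ0 (flux_bound_permCfg σ A κ hφ) hφL),
    bavg_expUnit L hL A (permSite σ q) (σ κ) (loop_small_of_flux L A _ _ hφ0 hφ hφL), val_expUnit, val_expUnit]
  refine (norm_exp_sub_exp_le _ _).trans (mul_le_mul_of_nonneg_left ?_ (norm_nonneg _))
  have h := norm_Tside_permCfg_sub_le L hL σ A q κ hδ0 hδ
  linarith [Real.exp_le_exp.mpr h]

end Comm

/-! ## §2 Non-vacuity: non-flat fields at which (42) is equivariant -/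

section CommWitness

variable {𝔸 : Type*} [NormedCommRing 𝔸] [NormedAlgebra ℂ 𝔸] [CompleteSpace 𝔸]

/-- **★ FOR EVERY SMALL CONSTANT CURVATURE THERE IS A FIELD WITH THAT CURVATURE AT WHICH (42) IS RELABELLING-EQUIVARIANT** — the
conjunction of `exists_const_flux` and `bavg_permCfg_expUnit_of_const_flux`: the equivariance instance is inhabited by non-flat
abelian fields (A6: the antecedent of §4 is not vacuous). [folklore] -/
theorem exists_nonflat_equivariant (L : ℕ) (hL : 1 ≤ L) (σ : Equiv.Perm (Fin d)) (f : Fin d → Fin d → 𝔸)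
    (hdiag : ∀ m : Fin d, f m m = 0) (hanti : ∀ m k : Fin d, m ≠ k → f k m = -f m k) {φ : ℝ} (hφ0 : 0 ≤ φ)
    (hφ : ∀ m k : Fin d, ‖f m k‖ ≤ φ) (hφL : d * (L : ℝ) ^ 2 * φ < Real.log 2) :
    ∃ A : Site d → Fin d → 𝔸, (∀ (p : Site d) (m k : Fin d), asum A p (plaqWord m k) = f m k) ∧
      bavg L (permCfg σ fun y μ => expUnit (A y μ)) = permCfg σ (bavg L fun y μ => expUnit (A y μ)) := by
  obtain ⟨A, hA⟩ := exists_const_flux f hdiag hanti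
  exact ⟨A, hA, bavg_permCfg_expUnit_of_const_flux L hL σ A f hA hφ0 hφ hφL⟩

end CommWitness

end

end Summit.QuantumFields.YangMills.BalabanUVNodes.N16Eq42PermutationDefectAbelian
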